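import Summits.CriticalPhenomena.PercolationContinuityZ3.Theorems.Transplant.FKConnectivityAllQApexMass
import HarnessLib

/-!
# Connectivity correlation inequalities for `φ_{w,q}`, every `q > 0` — file 9f: apex elimination, CONNECTION EVENTS AT THE APEX
# (the mass of `J_a ∩ F`, reachability of the apex from an arbitrary vertex, and the apex connection formula)

Support file (`--supports stmt-CriticalPhenomena-4575`), FK sub-lane `prim-bschramm-fk-1` (gen 5) of the post-continuity
programme; builds on p205010 (kernel theorem, internal audit signed; external expert review pending).  No definitions, no named
facts, no sorries; standard axioms.

Tools for computing two-point connection masses through a degree-2 apex `x` (pairs `a = ux`, `b = xv`), complementing the three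
apex identities of `…AllQApexMass.lean` (used there for pairs of PAIRS; here for pairs of VERTICES one of which is the apex):
* `FK.apex_mass_a_inter` (apex identity 4): `S_w(J_a ∩ F) = (w a)( q⁻¹((1 − w b) + (w b)q⁻¹) S_{w°}(F) − (q⁻¹−1)(w b)q⁻¹ S_{w°}(F ∩ K') )`
  for `F` insensitive to `a, b` (`w° = w[a↦0][b↦0]`, `K' = {u ↔ v avoiding a, b}`);
* `FK.reachable_apex_iff` (graph lemma G3): if the open pairs at `x` lie in `{a, b}` then for `y ≠ x`,
  `x ↔ y ⟺ (a open ∧ u ↔ y avoiding a,b) ∨ (b open ∧ v ↔ y avoiding a,b)`;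
* `FK.apex_mass_openConn`: `S_w(x ↔ y) = S_w(J_a ∩ F_u) + S_w(J_b ∩ F_v) − S_w(J_a ∩ J_b ∩ F_u ∩ F_v)` with `F_u = {u ↔ y avoiding a,b}`,
  `F_v = {v ↔ y avoiding a,b}` — each term is then given by apex identities 3 and 4.
Intended uses: EC⁺ for vertex pairs involving the apex (e.g. the tips of the diamond `K₄ − e`, which is what negative association
on `K₄` reduces to by the master identity), and explicit connection probabilities on small 2-trees.
[cite: Grimmett2006, Thm. (3.1)(a) (p. 37); §1.4 eq. (1.20) (p. 15)] [cite: Wagner2006, Ex. 5.1, §5.3]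
-/

noncomputable section

namespace Summit.CriticalPhenomena.PercolationContinuityZ3.Theorems

namespace FK

open MeasureTheory Set Literature.Probability.LatticeModels Literature.Probability.Percolation
open Literature.Probability.Percolation.DecisionTree (ind ind_of_mem ind_of_not_mem ind_nonneg)
open Literature.Probability.Percolation.TwoAvoidanceSets (ind_mul_ind)
open scoped Classical symmDiff

variable {V : Type*} [Fintype V]

/-! ### Further apex tools: the mass of `J_a ∩ F`, reachability of the apex from an arbitrary vertex, the apex connection formula -/

/-- **Apex identity 4**: for `F` insensitive to the apex pairs,
`S_w(J_a ∩ F) = (w a)·( q⁻¹((1 − w b) + (w b)q⁻¹)·S_{w°}(F) − (q⁻¹ − 1)(w b)q⁻¹·S_{w°}(F ∩ K') )`.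
[cite: Grimmett2006, Thm. (3.1)(a) (p. 37); §1.4 eq. (1.20) (p. 15)] -/
theorem apex_mass_a_inter (w : Sym2 V → unitInterval) {q : ℝ} (hq : q ≠ 0) {u v x : V} (hxu : x ≠ u) (hxv : x ≠ v)
    (huv : u ≠ v) (hw : ∀ e : Sym2 V, x ∈ e → ((w e : unitInterval) : ℝ) ≠ 0 → u ∈ e ∨ v ∈ e)
    (F : Set (BondConfig V)) (hFa : ∀ ω : BondConfig V, ω ∆ {s(u, x)} ∈ F ↔ ω ∈ F)
    (hFb : ∀ ω : BondConfig V, ω ∆ {s(x, v)} ∈ F ↔ ω ∈ F) :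
    ∑ ω : BondConfig V, rcWeightW w q ∅ ω * ind ({ω | s(u, x) ∈ ω} ∩ F) ω =
      ((w s(u, x) : unitInterval) : ℝ) *
        (q⁻¹ * ((1 - ((w s(x, v) : unitInterval) : ℝ)) + ((w s(x, v) : unitInterval) : ℝ) * q⁻¹) *
            ∑ ω : BondConfig V, rcWeightW (Function.update (Function.update w s(u, x) 0) s(x, v) 0) q ∅ ω * ind F ω -
          (q⁻¹ - 1) * ((w s(x, v) : unitInterval) : ℝ) * q⁻¹ *
            ∑ ω : BondConfig V, rcWeightW (Function.update (Function.update w s(u, x) 0) s(x, v) 0) q ∅ ω *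
              ind (F ∩ {ω : BondConfig V | ω \ {s(u, x), s(x, v)} ∈ (openConn u v : Set (BondConfig V))}) ω) := by
  have hab := apex_pairs_ne hxu huv
  set K : Set (BondConfig V) := {ω : BondConfig V | ω \ {s(u, x), s(x, v)} ∈ (openConn u v : Set (BondConfig V))} with hK
  have hw0 := apex_hyp_update hw s(u, x) (fun _ => Or.inl (Sym2.mem_mk_left u x)) 0
  have ha0 : ((Function.update w s(u, x) 0 s(u, x) : unitInterval) : ℝ) = 0 := by simp
  rw [sum_rcWeightW_ind_inter_openPair w q s(u, x) F, sum_rcWeightW_update_one_eq_toggle w hq u x F hFa,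
    sum_rcWeightW_ind_inter_compl (Function.update w s(u, x) 0) q F (openConn u x)]
  have hux : ∑ ω : BondConfig V, rcWeightW (Function.update w s(u, x) 0) q ∅ ω *
      ind (F ∩ (openConn u x : Set (BondConfig V))) ω =
      ∑ ω : BondConfig V, rcWeightW (Function.update w s(u, x) 0) q ∅ ω * ind ({ω | s(x, v) ∈ ω} ∩ (F ∩ K)) ω := by
    refine sum_rcWeightW_ind_congr_ae _ q fun ω hω => ?_
    have hapex := apex_of_rcWeightW_ne_zero _ q hxu hxv hw0 hω
    have ha : s(u, x) ∉ ω := not_mem_of_rcWeightW_ne_zero _ q ha0 hω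
    rw [Set.mem_inter_iff, mem_openConn_iff', reachable_ux_apex_iff hxu hxv hapex]
    simp only [ha, false_or, Set.mem_inter_iff, Set.mem_setOf_eq, hK]
    constructor
    · rintro ⟨hF, hb, hk⟩; exact ⟨hb, hF, hk⟩
    · rintro ⟨hb, hF, hk⟩; exact ⟨hF, hb, hk⟩
  have hFK : ∀ ω : BondConfig V, ω ∆ {s(x, v)} ∈ F ∩ K ↔ ω ∈ F ∩ K :=
    inter_insens hFb (apexAvoid_insens u v x (Or.inr rfl))
  rw [hux, sum_pendant_openPair (Function.update w s(u, x) 0) hq hxu hxv huv hw0 ha0 (F ∩ K) hFK,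
    sum_pendant_affine (Function.update w s(u, x) 0) hq hxu hxv huv hw0 ha0 F hFb,
    Function.update_of_ne hab.symm]
  ring

omit [Fintype V] in
/-- **Apex lemma G3**: if the open pairs at `x` lie in `{ux, xv}`, then for every vertex `y ≠ x`, `x ↔ y` iff `ux` is open and
`u ↔ y` avoiding the apex pairs, or `xv` is open and `v ↔ y` avoiding the apex pairs. [folklore] -/
theorem reachable_apex_iff {ω : BondConfig V} {u v x y : V} (hxv : x ≠ v) (hxy : x ≠ y)
    (hω : ∀ e ∈ ω, x ∈ e → e = s(u, x) ∨ e = s(x, v)) :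
    (openGraph ω).Reachable x y ↔
      (s(u, x) ∈ ω ∧ (openGraph (ω \ {s(u, x), s(x, v)})).Reachable u y) ∨
        (s(x, v) ∈ ω ∧ (openGraph (ω \ {s(u, x), s(x, v)})).Reachable v y) := by
  set ξ := ω \ {s(u, x), s(x, v)} with hξ
  have hiso := isolated_diff_apex hω
  have nx : ∀ z : V, z ≠ x → ¬ (openGraph ξ).Reachable x z := fun z hz => not_reachable_of_isolated hiso hz
  have nx' : ∀ z : V, z ≠ x → ¬ (openGraph ξ).Reachable z x := fun z hz => not_reachable_of_isolated' hiso hz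
  -- one-edge computations
  have hA : (openGraph ξ ⊔ SimpleGraph.edge u x).Reachable x y ↔ (openGraph ξ).Reachable u y := by
    rw [CoSunflowerGlue.reachable_sup_edge_iff']
    constructor
    · rintro (h | ⟨-, h⟩ | ⟨-, h⟩)
      · exact absurd h (nx y hxy.symm)
      · exact absurd h (nx y hxy.symm)
      · exact h
    · exact fun h => Or.inr (Or.inr ⟨SimpleGraph.Reachable.refl _, h⟩)
  have hB : ∀ H : SimpleGraph V, (∀ z : V, z ≠ x → ¬ H.Reachable x z) →
      ((H ⊔ SimpleGraph.edge x v).Reachable x y ↔ H.Reachable v y ∨ H.Reachable x y) := by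
    intro H hH
    rw [CoSunflowerGlue.reachable_sup_edge_iff']
    constructor
    · rintro (h | ⟨-, h⟩ | ⟨-, h⟩)
      · exact Or.inr h
      · exact Or.inl h
      · exact Or.inr h
    · rintro (h | h)
      · exact Or.inr (Or.inl ⟨SimpleGraph.Reachable.refl _, h⟩)
      · exact Or.inl h
  by_cases ha : s(u, x) ∈ ω <;> by_cases hb : s(x, v) ∈ ω
  · -- both apex pairs open
    have hωeq : ω = insert s(x, v) (insert s(u, x) ξ) := by
      ext e
      simp only [hξ, Set.mem_insert_iff, Set.mem_sdiff, Set.mem_singleton_iff]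
      constructor
      · intro he
        by_cases h1 : e = s(x, v)
        · exact Or.inl h1
        by_cases h2 : e = s(u, x)
        · exact Or.inr (Or.inl h2)
        · exact Or.inr (Or.inr ⟨he, fun h' => h'.elim h2 h1⟩)
      · rintro (rfl | rfl | ⟨he, -⟩)
        · exact hb
        · exact ha
        · exact he
    -- reachability facts in `ξ + ux`
    have hvy : (openGraph ξ ⊔ SimpleGraph.edge u x).Reachable v y ↔ (openGraph ξ).Reachable v y := by
      rw [CoSunflowerGlue.reachable_sup_edge_iff']
      constructor
      · rintro (h | ⟨-, h2⟩ | ⟨h1, -⟩)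
        · exact h
        · exact absurd h2 (nx y hxy.symm)
        · exact absurd h1 (nx' v hxv.symm)
      · exact fun h => Or.inl h
    have hB' : ((openGraph ξ ⊔ SimpleGraph.edge u x) ⊔ SimpleGraph.edge x v).Reachable x y ↔
        (openGraph ξ ⊔ SimpleGraph.edge u x).Reachable v y ∨ (openGraph ξ ⊔ SimpleGraph.edge u x).Reachable x y := by
      rw [CoSunflowerGlue.reachable_sup_edge_iff']
      constructor
      · rintro (h | ⟨-, h⟩ | ⟨-, h⟩)
        · exact Or.inr h
        · exact Or.inl h
        · exact Or.inr h
      · rintro (h | h)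
        · exact Or.inr (Or.inl ⟨SimpleGraph.Reachable.refl _, h⟩)
        · exact Or.inl h
    simp only [ha, hb, true_and]
    rw [hωeq, CoSunflowerGlue.openGraph_insert, CoSunflowerGlue.openGraph_insert, hB', hvy, hA, or_comm]
  · -- only `a`
    have hωeq : ω = insert s(u, x) ξ := by
      ext e
      simp only [hξ, Set.mem_insert_iff, Set.mem_sdiff, Set.mem_singleton_iff]
      constructor
      · intro he
        by_cases h : e = s(u, x)
        · exact Or.inl h
        · exact Or.inr ⟨he, fun h' => h'.elim h fun h'' => hb (h'' ▸ he)⟩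
      · rintro (rfl | ⟨he, -⟩)
        · exact ha
        · exact he
    simp only [ha, hb, true_and, false_and, or_false]
    rw [hωeq, CoSunflowerGlue.openGraph_insert, hA]
  · -- only `b`
    have hωeq : ω = insert s(x, v) ξ := by
      ext e
      simp only [hξ, Set.mem_insert_iff, Set.mem_sdiff, Set.mem_singleton_iff]
      constructor
      · intro he
        by_cases h : e = s(x, v)
        · exact Or.inl h
        · exact Or.inr ⟨he, fun h' => h'.elim (fun h'' => ha (h'' ▸ he)) h⟩
      · rintro (rfl | ⟨he, -⟩)
        · exact hb
        · exact he
    simp only [ha, hb, true_and, false_and, false_or]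
    rw [hωeq, CoSunflowerGlue.openGraph_insert, hB (openGraph ξ) nx]
    constructor
    · rintro (h | h)
      · exact h
      · exact absurd h (nx y hxy.symm)
    · exact fun h => Or.inl h
  · -- neither
    have hωeq : ω = ξ := by
      ext e
      simp only [hξ, Set.mem_sdiff, Set.mem_insert_iff, Set.mem_singleton_iff]
      constructor
      · intro he
        exact ⟨he, fun h' => h'.elim (fun h'' => ha (h'' ▸ he)) fun h'' => hb (h'' ▸ he)⟩
      · exact fun h => h.1
    simp only [ha, hb, false_and, or_self, iff_false]
    rw [hωeq]; exact nx y hxy.symm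

/-- **Apex connection formula**: for `y ≠ x` and the events `F_u = {u ↔ y avoiding the apex pairs}`, `F_v = {v ↔ y avoiding the
apex pairs}` (insensitive to the apex pairs),
`S_w(x ↔ y) = S_w(J_a ∩ F_u) + S_w(J_b ∩ F_v) − S_w(J_a ∩ J_b ∩ (F_u ∩ F_v))`, each term being given by the apex identities 3 and 4.
[cite: Grimmett2006, §1.4 eq. (1.20) (p. 15)] -/
theorem apex_mass_openConn (w : Sym2 V → unitInterval) (q : ℝ) {u v x y : V} (hxu : x ≠ u) (hxv : x ≠ v) (hxy : x ≠ y)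
    (hw : ∀ e : Sym2 V, x ∈ e → ((w e : unitInterval) : ℝ) ≠ 0 → u ∈ e ∨ v ∈ e) :
    ∑ ω : BondConfig V, rcWeightW w q ∅ ω * ind (openConn x y : Set (BondConfig V)) ω =
      ∑ ω : BondConfig V, rcWeightW w q ∅ ω *
          ind ({ω | s(u, x) ∈ ω} ∩ {ω : BondConfig V | ω \ {s(u, x), s(x, v)} ∈ (openConn u y : Set (BondConfig V))}) ω +
        ∑ ω : BondConfig V, rcWeightW w q ∅ ω *
          ind ({ω | s(x, v) ∈ ω} ∩ {ω : BondConfig V | ω \ {s(u, x), s(x, v)} ∈ (openConn v y : Set (BondConfig V))}) ω -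
        ∑ ω : BondConfig V, rcWeightW w q ∅ ω *
          ind ({ω | s(u, x) ∈ ω} ∩ ({ω | s(x, v) ∈ ω} ∩
            ({ω : BondConfig V | ω \ {s(u, x), s(x, v)} ∈ (openConn u y : Set (BondConfig V))} ∩
              {ω : BondConfig V | ω \ {s(u, x), s(x, v)} ∈ (openConn v y : Set (BondConfig V))}))) ω := by
  rw [eq_sub_iff_add_eq, ← Finset.sum_add_distrib, ← Finset.sum_add_distrib]
  refine Finset.sum_congr rfl fun ω _ => ?_
  by_cases hz : rcWeightW w q ∅ ω = 0
  · simp only [hz, zero_mul, add_zero]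
  have hapex := apex_of_rcWeightW_ne_zero _ q hxu hxv hw hz
  have key := reachable_apex_iff (u := u) (y := y) hxv hxy hapex
  rw [← mul_add, ← mul_add]
  congr 1
  -- indicator identity `1_{x↔y} + 1_{A∩B∩…} = 1_{A…} + 1_{B…}` from `x ↔ y ⟺ (a ∧ F_u) ∨ (b ∧ F_v)`
  simp only [ind, Set.mem_inter_iff, Set.mem_setOf_eq, mem_openConn_iff'] at *
  by_cases h1 : s(u, x) ∈ ω ∧ (openGraph (ω \ {s(u, x), s(x, v)})).Reachable u y <;>
    by_cases h2 : s(x, v) ∈ ω ∧ (openGraph (ω \ {s(u, x), s(x, v)})).Reachable v y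
  · rw [if_pos (key.2 (Or.inl h1)), if_pos h1, if_pos h2, if_pos ⟨h1.1, h2.1, h1.2, h2.2⟩]
  · rw [if_pos (key.2 (Or.inl h1)), if_pos h1, if_neg h2, if_neg (fun h => h2 ⟨h.2.1, h.2.2.2⟩)]
  · rw [if_pos (key.2 (Or.inr h2)), if_neg h1, if_pos h2, if_neg (fun h => h1 ⟨h.1, h.2.2.1⟩)]; ring
  · rw [if_neg (fun h => (key.1 h).elim h1 h2), if_neg h1, if_neg h2, if_neg (fun h => h1 ⟨h.1, h.2.2.1⟩)]

end FK

end Summit.CriticalPhenomena.PercolationContinuityZ3.Theorems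

end
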